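import Summits.Schanuel.Schanuel.Theorems.RootDecomp1KW4Coprime03

/-! PORT (census-1 g29, ×0 RECORD PORT of the census kernel scratch «W4PURE» W4Pure.lean fcd53bfa…; INSTRUMENT NOTE 75 L3378, writer NOTE 26
 L3380, crit ACK + PRICE ×0 + PORT GO L3382 «NODE-34 / L3366 TERMS + K-R62») — part 4 (RootDecomp1KW4Coprime04): §8 bounded denominators
 on the COPRIME and the SQUARE class (`den_lt_of_coprimeClass`, `den_lt_of_squareClass`), §9 LEVEL FINITENESS on the pure classes
 (`levels_finite_pureClasses`) and the thin-fibre clause there at EVERY quality (`clause_W4P_pureClasses`, superseding part 02's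
 `clause_two_W4P_coprimeClass` by `Or.inl` — crit PROBE P2 L3382). PORT EDIT (m2′, declared): `isCoprime_num_den` as a PRIVATE copy —
 the THIRD copy of this two-line fact (Literature original `Literature.NumberTheory.DiophantineApproximation.SparseDyadicRationals.isCoprime_num_den`
 + part 02 + here; to be folded into one public citation at a later content-bearing touch, crit L3382 (c)); everything else VERBATIM from the
 scratch. `--supports stmt-Schanuel-33364`; no census credit; ×0 record port; does NOT prove `LevelFinite W4P` / `ThinFibreAt m₀ W4P` /
 stmt-Schanuel-33364; the mixed class is open; row 36 UNDECIDED OF RECORD. -/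

/-!
# RootDecomp1KW4Coprime — part 4: bounded denominators and LEVEL FINITENESS FOR W4 ON THE PURE CLASSES, the clause at every `m₀`

HEADLINES: `levels_finite_pureClasses (C : ℝ) : {N | ∃ r : ℚ, |r| ≤ C ∧ bev W4P (partialSum 2 N) r = 0 ∧ ∃ c : ℤ,
((psNumer 2 N : ℤ) = r.den * c ∧ IsCoprime (r.den : ℤ) c) ∨ (psNumer 2 N : ℤ) = r.den ^ 2 * c}.Finite` and
`clause_W4P_pureClasses (C) (m₀) : ∃ N₀, ∀ N ≥ N₀, ∀ r, |r| ≤ C → bev W4P (partialSum 2 N) r = 0 → ∀ c, (… ∨ …) →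
C * 2 ^ (N + 1)! < (r.den : ℝ) ^ (m₀ * N)`.  From part 03: `Ñ = T·b⁴·k` with `|Ñ| < T·b³·B(C)`, so `k = 0` (then
`(5a − b)(a + b) = 0`, `r ∈ {1/5, −1}`, `den r ≤ 5`) or `den r < B(C)`; rationals of bounded height are finitely many and each lies
on finitely many levels (`W4P(·, r)` is a non-zero polynomial in `x` — `(r⁴−17, r³+1, r+2)` never vanish together —, `N ↦ s_N` is
injective).  A PARTIAL, hypothesis-free, elementary statement: the MIXED class of level points (denominator meeting `p_N` at primes
of both kinds) is untouched, so this does NOT decide `LevelFinite W4P` / row 36 and moves no binder (`PadicSubspace` of record); rung 0.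
-/

noncomputable section

open Polynomial LiouvilleNumber
open scoped Nat

namespace Summit.Schanuel.Schanuel.Theorems.RootDecomp1KW4Coprime

open Summit.Schanuel.Schanuel.Theorems.RootDecomp1KTwoBaseCell (psNumer partialSum_eq_psNumer_div coprime_psNumer)
open Summit.Schanuel.Schanuel.Theorems.RootDecomp1KRelLiouvilleCell (partialSum_two_strictMono)
open Summit.Schanuel.Schanuel.Theorems.RootDecomp1KDegreeLadder
open Summit.Schanuel.Schanuel.Theorems.RootDecomp1KOddEmpty
open Summit.Schanuel.Schanuel.Theorems.RootDecomp1KRunge (psNumer_pos_runge)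
open Summit.Schanuel.Schanuel.Theorems.RootDecomp1KLevelFinite (lac_partialSum_two)

/-! ### §8 Bounded denominators on the pure classes -/

/-- `num r` and `den r` are coprime in `ℤ` (PRIVATE copy — the THIRD copy of this two-line fact: verbatim twin of
`Literature.NumberTheory.DiophantineApproximation.SparseDyadicRationals.isCoprime_num_den` and of part 02's private copy; to be
folded into one public citation at a later content-bearing touch, crit L3382 (c)). -/
private theorem isCoprime_num_den (r : ℚ) : IsCoprime r.num (r.den : ℤ) := by
  rw [Int.isCoprime_iff_gcd_eq_one, Int.gcd_eq_natAbs]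
  simpa using r.reduced

/-- from `Ñ₁Ñ₂ = 16T²b⁴(5a−b)(a+b)` and `Ñᵢ = 0`: `r ∈ {1/5, −1}`, so `den r ≤ 5`. -/
theorem den_le_five_of_zero {r : ℚ} (h : (5 * r.num - r.den) * (r.num + r.den) = 0) : r.den ≤ 5 := by
  have hcop := isCoprime_num_den r
  rcases mul_eq_zero.mp h with h1 | h1
  · -- b = 5a ⇒ a a unit ⇒ b = 5
    have hb : (r.den : ℤ) = 5 * r.num := by linarith
    have hu : IsUnit r.num := by
      have : IsCoprime r.num (5 * r.num) := hb ▸ hcop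
      exact (isCoprime_self.mp this.of_mul_right_right)
    rcases Int.isUnit_iff.mp hu with h2 | h2 <;>
      · have : (r.den : ℤ) ≤ 5 := by rw [hb, h2]; norm_num
        exact_mod_cast this
  · -- a = −b ⇒ b a unit ⇒ b = 1
    have ha : r.num = -(r.den : ℤ) := by linarith
    have hu : IsUnit (r.den : ℤ) := by
      have : IsCoprime (-(r.den : ℤ)) (r.den : ℤ) := ha ▸ hcop
      exact isCoprime_self.mp ((IsCoprime.neg_left_iff _ _).mp this)
    rcases Int.isUnit_iff.mp hu with h2 | h2
    · have : (r.den : ℤ) ≤ 5 := by rw [h2]; norm_num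
      exact_mod_cast this
    · exfalso; have := r.den_pos; omega

/-- common data of a level point `(s_N, r)`, `N ≥ 2`: positivity, the integer level equation, coprimalities, sizes. -/
theorem level_data {C : ℝ} {N : ℕ} (hN : 2 ≤ N) {r : ℚ} (hr : |(r : ℝ)| ≤ C)
    (hP : bev W4P (partialSum 2 N) r = 0) {c : ℤ} (hpc : (psNumer 2 N : ℤ) = r.den * c) :
    0 < (r.den : ℤ) ∧ 0 < c ∧ (0 : ℤ) < 2 ^ N ! ∧ levelE r.num r.den (r.den * c) (2 ^ N !) = 0 ∧
      IsCoprime r.num (r.den : ℤ) ∧ IsCoprime (r.den : ℤ) 2 ∧ IsCoprime ((r.den : ℤ) * c) (2 ^ N !) ∧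
      (r.den : ℤ) * c < 2 * 2 ^ N ! ∧ |((r.num : ℤ) : ℝ)| ≤ C * ((r.den : ℤ) : ℝ) := by
  have hb0 : (0 : ℤ) < r.den := by exact_mod_cast r.den_pos
  have hp0 : (0 : ℤ) < psNumer 2 N := by exact_mod_cast psNumer_pos_runge N
  have hc0 : 0 < c := by
    rcases lt_trichotomy c 0 with h | h | h
    · exfalso; have : (r.den : ℤ) * c < 0 := mul_neg_of_pos_of_neg hb0 h; linarith
    · exfalso; rw [h, mul_zero] at hpc; linarith
    · exact h
  have hp2 : IsCoprime (psNumer 2 N : ℤ) (2 : ℤ) := by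
    have h := Nat.isCoprime_iff_coprime.mpr (coprime_psNumer 2 hN)
    exact_mod_cast h
  rw [hpc] at hp2
  have hlt : (r.den : ℤ) * c < 2 * 2 ^ N ! := by
    rw [← hpc]; exact_mod_cast psNumer_lt N
  have hbR : (0 : ℝ) < ((r.den : ℤ) : ℝ) := by exact_mod_cast hb0
  have haC : |((r.num : ℤ) : ℝ)| ≤ C * ((r.den : ℤ) : ℝ) := by
    have e : (r : ℝ) = (r.num : ℝ) / (r.den : ℝ) := by rw [Rat.cast_def]
    have h1 := hr
    rw [e, abs_div] at h1
    have hden : |((r.den : ℕ) : ℝ)| = ((r.den : ℤ) : ℝ) := by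
      rw [abs_of_pos (by exact_mod_cast r.den_pos)]; norm_cast
    rw [hden] at h1
    have := (div_le_iff₀ hbR).mp h1
    simpa using this
  exact ⟨hb0, hc0, by positivity, by rw [← hpc]; exact levelE_eq_zero hP, isCoprime_num_den r,
    hp2.of_mul_left_left, hp2.pow_right, hlt, haC⟩

/-- **COPRIME CLASS: bounded denominator.**  At a level `N ≥ 2`, a point `(s_N, r)` of `W4P` with `|r| ≤ C` (`C ≥ 0`)
whose denominator divides `p_N` with a cofactor coprime to it has `den r < B(C)`. -/
theorem den_lt_of_coprimeClass {C : ℝ} (hC : 0 ≤ C) {N : ℕ} (hN : 2 ≤ N) {r : ℚ} (hr : |(r : ℝ)| ≤ C)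
    (hP : bev W4P (partialSum 2 N) r = 0) {c : ℤ} (hpc : (psNumer 2 N : ℤ) = r.den * c)
    (hcop : IsCoprime (r.den : ℤ) c) : (r.den : ℝ) < denBound C := by
  obtain ⟨hb0, hc0, hT0, hE, hab, hb2, hpT, hlt, haC⟩ := level_data hN hr hP hpc
  set b : ℤ := (r.den : ℤ) with hb
  set T : ℤ := 2 ^ N ! with hT
  have hdR : (r.den : ℝ) = ((b : ℤ) : ℝ) := by rw [hb]; norm_cast
  obtain ⟨k, hk⟩ := dvd_runN2_of_coprime hb0.ne' hE hcop hab hb2 hpT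
  obtain ⟨hsz, -⟩ := abs_runN_lt hC hb0 hc0 hT0 hlt haC
  have hbR : (0 : ℝ) < b := by exact_mod_cast hb0
  have hTR : (0 : ℝ) < T := by exact_mod_cast hT0
  have hB81 : (81 : ℝ) ≤ denBound C := by unfold denBound; nlinarith [pow_nonneg hC 4, pow_nonneg hC 3, pow_nonneg hC 2]
  rcases eq_or_ne k 0 with hk0 | hk0
  · -- Ñ₂ = 0 ⇒ (5a − b)(a + b) = 0 ⇒ den r ≤ 5
    have hE0 : levelE0 r.num b c T = 0 := by
      have := levelE_eq r.num b c T
      rw [hE] at this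
      rcases mul_eq_zero.mp this.symm with h | h
      · exact absurd (pow_eq_zero_iff two_ne_zero |>.mp h) hb0.ne'
      · exact h
    have h0 : 16 * T ^ 2 * b ^ 4 * ((5 * r.num - b) * (r.num + b)) = 0 := by
      have := runN1_mul_runN2 r.num b c T
      rw [hk, hk0, mul_zero, mul_zero, hE0, mul_zero, sub_zero] at this
      linear_combination -this
    have hne : 16 * T ^ 2 * b ^ 4 ≠ 0 := by positivity
    have h5 := den_le_five_of_zero (r := r) ((mul_eq_zero.mp h0).resolve_left hne)
    calc (r.den : ℝ) ≤ 5 := by exact_mod_cast h5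
      _ < denBound C := by linarith
  · -- T·b⁴·|k| = |Ñ₂| < T·b³·B ⇒ b < B
    have h1 : (T : ℝ) * b ^ 4 ≤ |(runN2 r.num b c T : ℝ)| := by
      rw [hk]; push_cast
      rw [abs_mul, abs_mul, abs_of_pos hTR, abs_of_pos (by positivity : (0:ℝ) < (b:ℝ) ^ 4)]
      have : (1 : ℝ) ≤ |(k : ℝ)| := by
        rw [← Int.cast_abs]; exact_mod_cast Int.one_le_abs hk0
      nlinarith [mul_pos hTR (pow_pos hbR 4)]
    have h2 : (T : ℝ) * b ^ 4 < T * b ^ 3 * denBound C := h1.trans_lt hsz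
    have h3 : (b : ℝ) < denBound C := by
      by_contra h
      push Not at h
      have : (T : ℝ) * b ^ 3 * denBound C ≤ T * b ^ 4 := by
        have := mul_le_mul_of_nonneg_left h (le_of_lt (mul_pos hTR (pow_pos hbR 3)))
        calc (T : ℝ) * b ^ 3 * denBound C ≤ T * b ^ 3 * b := this
          _ = T * b ^ 4 := by ring
      linarith
    rwa [hdR]

/-- **SQUARE CLASS: bounded denominator.**  At a level `N ≥ 2`, a point `(s_N, r)` of `W4P` with `|r| ≤ C` (`C ≥ 0`)
with `(den r)² ∣ p_N` has `den r < B(C)`. -/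
theorem den_lt_of_squareClass {C : ℝ} (hC : 0 ≤ C) {N : ℕ} (hN : 2 ≤ N) {r : ℚ} (hr : |(r : ℝ)| ≤ C)
    (hP : bev W4P (partialSum 2 N) r = 0) {c' : ℤ} (hpc : (psNumer 2 N : ℤ) = r.den ^ 2 * c') :
    (r.den : ℝ) < denBound C := by
  have hpc' : (psNumer 2 N : ℤ) = r.den * (r.den * c') := by rw [hpc]; ring
  obtain ⟨hb0, hc0, hT0, hE, hab, hb2, hpT, hlt, haC⟩ := level_data hN hr hP hpc'
  set b : ℤ := (r.den : ℤ) with hb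
  set T : ℤ := 2 ^ N ! with hT
  have hdR : (r.den : ℝ) = ((b : ℤ) : ℝ) := by rw [hb]; norm_cast
  obtain ⟨k, hk⟩ := dvd_runN1_of_square hb0.ne' hE hab hb2 hpT
  obtain ⟨-, hsz⟩ := abs_runN_lt hC hb0 hc0 hT0 hlt haC
  have hbR : (0 : ℝ) < b := by exact_mod_cast hb0
  have hTR : (0 : ℝ) < T := by exact_mod_cast hT0
  have hB81 : (81 : ℝ) ≤ denBound C := by unfold denBound; nlinarith [pow_nonneg hC 4, pow_nonneg hC 3, pow_nonneg hC 2]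
  rcases eq_or_ne k 0 with hk0 | hk0
  · have hE0 : levelE0 r.num b (b * c') T = 0 := by
      have := levelE_eq r.num b (b * c') T
      rw [hE] at this
      rcases mul_eq_zero.mp this.symm with h | h
      · exact absurd (pow_eq_zero_iff two_ne_zero |>.mp h) hb0.ne'
      · exact h
    have h0 : 16 * T ^ 2 * b ^ 4 * ((5 * r.num - b) * (r.num + b)) = 0 := by
      have := runN1_mul_runN2 r.num b (b * c') T
      rw [hk, hk0, mul_zero, zero_mul, hE0, mul_zero, sub_zero] at this
      linear_combination -this
    have hne : 16 * T ^ 2 * b ^ 4 ≠ 0 := by positivity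
    have h5 := den_le_five_of_zero (r := r) ((mul_eq_zero.mp h0).resolve_left hne)
    calc (r.den : ℝ) ≤ 5 := by exact_mod_cast h5
      _ < denBound C := by linarith
  · have h1 : (T : ℝ) * b ^ 4 ≤ |(runN1 r.num b (b * c') T : ℝ)| := by
      rw [hk]; push_cast
      rw [abs_mul, abs_mul, abs_of_pos hTR, abs_of_pos (by positivity : (0:ℝ) < (b:ℝ) ^ 4)]
      have : (1 : ℝ) ≤ |(k : ℝ)| := by
        rw [← Int.cast_abs]; exact_mod_cast Int.one_le_abs hk0
      nlinarith [mul_pos hTR (pow_pos hbR 4)]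
    have h2 : (T : ℝ) * b ^ 4 < T * b ^ 3 * denBound C := h1.trans_lt hsz
    have h3 : (b : ℝ) < denBound C := by
      by_contra h
      push Not at h
      have : (T : ℝ) * b ^ 3 * denBound C ≤ T * b ^ 4 := by
        have := mul_le_mul_of_nonneg_left h (le_of_lt (mul_pos hTR (pow_pos hbR 3)))
        calc (T : ℝ) * b ^ 3 * denBound C ≤ T * b ^ 3 * b := this
          _ = T * b ^ 4 := by ring
      linarith
    rwa [hdR]

/-! ### §9 Level finiteness on the pure classes; the clause at every quality `m₀` -/

/-- rationals with `|r| ≤ K` and `den r < B` form a finite set. -/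
theorem finite_rat_bounded (K B : ℝ) : {r : ℚ | |(r : ℝ)| ≤ K ∧ (r.den : ℝ) < B}.Finite := by
  refine (((Set.finite_Icc (-(⌈K * B⌉₊ : ℤ)) (⌈K * B⌉₊ : ℤ)).prod (Set.finite_Icc (0 : ℕ) ⌈B⌉₊)).image
    (fun p : ℤ × ℕ => ((p.1 : ℚ) / (p.2 : ℚ)))).subset ?_
  rintro r ⟨hr, hd⟩
  have hK : 0 ≤ K := (abs_nonneg _).trans hr
  have hdpos : (0 : ℝ) < r.den := by exact_mod_cast r.den_pos
  have hnum : |(r.num : ℝ)| ≤ K * B := by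
    have e : (r : ℝ) = (r.num : ℝ) / (r.den : ℝ) := by rw [Rat.cast_def]
    rw [e, abs_div, abs_of_pos hdpos, div_le_iff₀ hdpos] at hr
    exact hr.trans (mul_le_mul_of_nonneg_left hd.le hK)
  have hnumZ : |r.num| ≤ (⌈K * B⌉₊ : ℤ) := by
    have h1 : |(r.num : ℝ)| ≤ (⌈K * B⌉₊ : ℕ) := hnum.trans (Nat.le_ceil _)
    have h2 : ((|r.num| : ℤ) : ℝ) ≤ ((⌈K * B⌉₊ : ℕ) : ℤ) := by
      rw [Int.cast_abs]; exact_mod_cast h1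
    exact_mod_cast h2
  refine ⟨(r.num, r.den), ⟨?_, ?_⟩, Rat.num_div_den r⟩
  · exact Set.mem_Icc.mpr (abs_le.mp hnumZ)
  · refine Set.mem_Icc.mpr ⟨Nat.zero_le _, ?_⟩
    have : (r.den : ℝ) ≤ (⌈B⌉₊ : ℕ) := hd.le.trans (Nat.le_ceil _)
    exact_mod_cast this

/-- for a fixed rational `r` only finitely many levels carry a point `(s_N, r)` of `W4P` (`W4P(·, r)` is a non-zero
polynomial in `x` — its coefficients `(r⁴ − 17, r³ + 1, r + 2)` never vanish together — and `N ↦ s_N` is injective). -/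
theorem levels_finite_of_rat (r : ℚ) : {N : ℕ | bev W4P (partialSum 2 N) r = 0}.Finite := by
  set q : ℝ[X] := Polynomial.C ((r : ℝ) ^ 4 - 17) * X ^ 2 + Polynomial.C ((r : ℝ) ^ 3 + 1) * X +
    Polynomial.C ((r : ℝ) + 2) with hq
  have hq0 : q ≠ 0 := by
    intro h
    have h0 := congrArg (fun p : ℝ[X] => p.coeff 0) h
    have h1 := congrArg (fun p : ℝ[X] => p.coeff 1) h
    simp only [hq, Polynomial.coeff_add, Polynomial.coeff_C_mul, Polynomial.coeff_X_pow, Polynomial.coeff_X,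
      Polynomial.coeff_C, Polynomial.coeff_zero] at h0 h1
    norm_num at h0 h1
    have hr2 : (r : ℝ) = -2 := by linarith
    rw [hr2] at h1
    norm_num at h1
  have heval : ∀ x : ℝ, bev W4P x r = q.eval x := by
    intro x; rw [bev_W4P, hq]
    simp only [Polynomial.eval_add, Polynomial.eval_mul, Polynomial.eval_C, Polynomial.eval_pow, Polynomial.eval_X]
    ring
  have hfin : {x : ℝ | q.IsRoot x}.Finite := Polynomial.finite_setOf_isRoot hq0
  refine (Set.Finite.preimage (partialSum_two_strictMono.injective.injOn) hfin).subset ?_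
  intro N hN
  simp only [Set.mem_preimage, Set.mem_setOf_eq, Polynomial.IsRoot]
  rw [← heval]; exact hN

/-- **LEVEL FINITENESS FOR W4 ON THE PURE CLASSES** (hypothesis-free, elementary): the levels `N` carrying a point
`(s_N, r)` of `W4P` with `|r| ≤ C` whose denominator either divides `p_N` with a COPRIME cofactor (the point never meets
the branch `x ~ −1/Y²` of the node `(0, ∞)` at an odd prime) or has its SQUARE dividing `p_N` (never meets the branch
`x ~ −1/Y`) form a FINITE set.  The mixed class is untouched — this does not decide `LevelFinite W4P`. -/
theorem levels_finite_pureClasses (C : ℝ) :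
    {N : ℕ | ∃ r : ℚ, |(r : ℝ)| ≤ C ∧ bev W4P (partialSum 2 N) r = 0 ∧
      ∃ c : ℤ, ((psNumer 2 N : ℤ) = r.den * c ∧ IsCoprime (r.den : ℤ) c) ∨
        (psNumer 2 N : ℤ) = r.den ^ 2 * c}.Finite := by
  set C₀ : ℝ := max C 0 with hC₀
  have hC0 : 0 ≤ C₀ := le_max_right _ _
  have hfinS := finite_rat_bounded C₀ (denBound C₀)
  have hbig : (⋃ r ∈ {r : ℚ | |(r : ℝ)| ≤ C₀ ∧ (r.den : ℝ) < denBound C₀},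
      {N : ℕ | bev W4P (partialSum 2 N) r = 0}).Finite :=
    hfinS.biUnion fun r _ => levels_finite_of_rat r
  refine ((Set.finite_le_nat 1).union hbig).subset ?_
  rintro N ⟨r, hr, hP, c, hc⟩
  by_cases hN : N ≤ 1
  · exact Or.inl hN
  · right
    have hN2 : 2 ≤ N := by omega
    have hr0 : |(r : ℝ)| ≤ C₀ := hr.trans (le_max_left _ _)
    have hden : (r.den : ℝ) < denBound C₀ := by
      rcases hc with ⟨hpc, hcop⟩ | hpc
      · exact den_lt_of_coprimeClass hC0 hN2 hr0 hP hpc hcop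
      · exact den_lt_of_squareClass hC0 hN2 hr0 hP hpc
    exact Set.mem_biUnion (show r ∈ {r : ℚ | |(r : ℝ)| ≤ C₀ ∧ (r.den : ℝ) < denBound C₀} from ⟨hr0, hden⟩) hP

/-- **THE THIN-FIBRE CLAUSE FOR W4 ON THE PURE CLASSES, AT EVERY QUALITY `m₀`** (vacuous beyond the last pure-class
level): in particular the tree's `ThinFibreAt m₀ W4P` restricted to the pure classes, for every `m₀` — superseding
`clause_two_W4P_coprimeClass` (`m₀ = 2`, coprime class). -/
theorem clause_W4P_pureClasses (C : ℝ) (m₀ : ℕ) :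
    ∃ N₀ : ℕ, ∀ N : ℕ, N₀ ≤ N → ∀ r : ℚ, |(r : ℝ)| ≤ C → bev W4P (partialSum 2 N) r = 0 →
      ∀ c : ℤ, (((psNumer 2 N : ℤ) = r.den * c ∧ IsCoprime (r.den : ℤ) c) ∨
        (psNumer 2 N : ℤ) = r.den ^ 2 * c) → C * 2 ^ (N + 1)! < (r.den : ℝ) ^ (m₀ * N) := by
  obtain ⟨M, hM⟩ := (levels_finite_pureClasses C).bddAbove
  refine ⟨M + 1, fun N hN r hr hP c hc => ?_⟩
  have : N ≤ M := hM ⟨r, hr, hP, c, hc⟩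
  omega

end Summit.Schanuel.Schanuel.Theorems.RootDecomp1KW4Coprime

end
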